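import Literature.MeasureTheory.Group.InvariantQuotientPi                 -- ★ `quotientPiHomeomorph`, `exists_eq_smul_map_symm_pi`, `smulInvariantMeasure_map_symm_pi`, `isFiniteMeasureOnCompacts_map_symm_pi`, `map_symm_pi_ne_zero`
import Literature.MeasureTheory.Group.InvariantQuotientOrbitalProd        -- ★ `exists_map_cosetCongr_eq_smul_map_symm_prod`, `descConj_cosetCongr_prodEquiv_symm`, `centralizer_comm`, `smulInvariantMeasure_map_cosetCongr_of_smulInvariant`
import Literature.NumberTheory.Rogawski1990.ArchHSBallVolumeProduct       -- ★ p848675 (LH3-p03) §1 `exists_pi_measure_setOf_prod_le_of_marginal_growth`; brings ★ `archPiEquivCM`, ★ `archLocal` instances, ★ `archHSGL_endoEmbArch`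
import Literature.NumberTheory.Rogawski1990.TransferFactsCanonical        -- ★ `OrbitalMeasureFamily.IsQuotientOf` ((W_H)), `isClosed_coe_centralizer_singleton`
import Literature.NumberTheory.Rogawski1990.ArchimedeanTransfer           -- ★ `IsArchGRegular`
import HarnessLib

/-!
# «Places multiply» ON THE QUOTIENT: polynomial growth of orbit HS-balls for ANY invariant measure on `H_∞ ⧸ Z(γ)` from per-place growth
# (Beuzart-Plessis, Astérisque 418 (2020), §1.5 (1.5.2)–(1.5.3) p. 31; Folland (1995) Thm. 2.49; Gelbart (1975) p. 155 (10.19))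

Topic `NumberTheory/Rogawski1990`; namespace `Literature.NumberTheory.Rogawski1990`.  THEOREMS ONLY (no `def`, no instance, no notation, no axiom, no named fact,
no `sorry`).  Cell `pub/hodgecm-mathlib`, line LH3 (crux H413 = `stmt-HodgeConjecture-24833`), DEAL #17 «(ASM-pi-quot)» of the (VOL)∕(CONV) board: the
ORBIT-SIDE companion of ★ `haar_setOf_prod_place_le_of_marginal_growth` (`ArchHSBallVolumeProduct` §2, which is the GROUP side).  It supplies the `hvol` binder of
★ `integrable_descConj_of_archSchwartzGL_of_volumeGrowth` ∕ ★ `integrable_orbitalIntegrand_of_archSchwartzGL_of_volumeGrowth` (`ArchSchwartzOrbitalIntegralConvergence`,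
LH3-p04) at an ARBITRARY class from per-place quotient bounds — the (h-piquot) token of DEAL #18 «(CONV-total)».

MATHEMATICS.  `H_∞ = U(Φ₂)(L⁺ ⊗ ℝ) × U(Φ₁)(L⁺ ⊗ ℝ)`, `U(Φ₂)(L⁺ ⊗ ℝ) ≅ Π_w U(Φ₂)_w` over the complex places `w` of the CM field `L` (★ `archPiEquivCM`, a `≃ₜ*`), and
`U(Φ₁)(L⁺ ⊗ ℝ)` is COMPACT.  For `γ = (γ₂, γ₁) ∈ H_∞` the centraliser is `Z(γ) ≅ (Π_w Z_w(γ_{2,w})) × Z(γ₁)`, so `H_∞ ⧸ Z(γ) ≅ (Π_w U(Φ₂)_w ⧸ Z_w) × (U(Φ₁)_∞ ⧸ Z(γ₁))`,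
the last factor compact.  An invariant Radon measure on a homogeneous space is unique up to a scalar (Folland Thm. 2.49), hence EVERY non-zero invariant measure
`μ` on `H_∞ ⧸ Z(γ)` finite on compact sets is, in these coordinates, `c • (⨂_w μ_w) ⊗ μ₁` for any chosen non-zero invariant `μ_w` on the place quotients
(★ `exists_map_cosetCongr_eq_smul_map_symm_prod`, ★ `exists_map_cosetCongr_eq_smul_map_symm_pi` — Gelbart's (10.19) at the level of measures).  The orbit
«HS-ball» `{y Z(γ) ∣ ∏_w F_w((y γ y⁻¹)_{2,w}) ≤ R}` reads `{(ȳ_w) ∣ ∏_w F_w(ȳ_w γ_w ȳ_w⁻¹) ≤ R} × (everything)` there (★ `descConj_cosetCongr_*`), and the dyadic-box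
lemma ★ `exists_pi_measure_setOf_prod_le_of_marginal_growth` turns per-place bounds `μ_w{F_w ≤ ρ} ≤ C ρ^a` into `≤ A R^a (1 + log R)^m`.  No measurability of the
balls is needed (upper bounds through `Measure.le_map_apply`).

* §0 (private) finite-product glue `C((γ_i)) = Π C(γ_i)`, the orbital integrand in product coordinates, and «an invariant measure on `G ⧸ C(γ)` is `c • ⊠ μ_i`» over
  ★ `exists_eq_smul_map_symm_pi` — the three lemmas ★ `InvariantQuotientOrbitalPi` carries BY NAME (`centralizer_singleton_pi_eq`, `descConj_cosetCongr_quotientPiEquiv_symm`,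
  `exists_map_cosetCongr_eq_smul_map_symm_pi`); re-derived privately here ONLY because that module has no served olean on the hub (accepted 2026-08-15, never built:
  `remote:stale:…:unbuilt`), to be swapped for the import once it is built.
* §1 `measure_setOf_descConj_le_of_pi_marginal_growth` — abstract finite-product step (`e : (Π_i G_i) ≃* G`; any invariant `μ` on `G ⧸ C(γ)`).
* §2 `smulInvariantMeasure_map_mk_of_isMulLeftInvariant`, `measure_setOf_descConj_le_of_prod_compactSpace` — abstract compact-factor step (`e : G₁ × G₂ ≃* G`,
  `G₂` compact; the bound passes from `G₁ ⧸ C(γ₁)` to `G ⧸ C(γ)` with the same exponent and log-power).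
* §3 `measure_setOf_descConj_le_of_piProd_marginal_growth` — §2 ∘ §1 in the frame `e : (Π_i G_i) × G₂ ≃* G` of ★ `lintegral_descConj_quotientMeasure_eq_prod_mul`.
* §4 THE `H_∞` DRESS: `measure_setOf_descConj_prod_place_le_of_marginal_growth` (any per-place `F_w ≥ 1`) and **`measure_setOf_descConj_archHSGL_endoEmbArch_le`** —
  the Hilbert–Schmidt reading `archHSGL(ι_∞(y γ y⁻¹)) = ∏_w (‖(y γ y⁻¹)_{2,w}‖²_HS + 1)` (★ `archHSGL_endoEmbArch`), i.e. the `hvol` binder of ★ p848470 TOKEN FOR TOKEN, from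
  per-place quotient growth `μ_w{ȳ ∣ ‖ȳ γ_w ȳ⁻¹‖²_HS + 1 ≤ ρ} ≤ C ρ^a` for ANY ONE non-zero invariant σ-finite `μ_w` per place (elliptic places: compact `Z_w`;
  split places: the `K·N` slab reading — both supplied elsewhere on the board).
HONEST LABEL: HC_CM is proved only modulo the 7 printed citations (2 remaining: hLiu418 = `stmt-HodgeConjecture-24832`, h413 = `stmt-HodgeConjecture-24833`) until rung 0 closes;
this file is measure-theoretic plumbing behind (CONV) and pays no organ by itself.

## References
* [BeuzartPlessis2020Asterisque] R. Beuzart-Plessis, Astérisque 418 (2020), §1.5 (1.5.2)–(1.5.3) p. 31 (polynomial growth of weighted balls; convergence of Schwartz orbital integrals).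
* [Folland1995] G. B. Folland, *A Course in Abstract Harmonic Analysis* (1995), §2.6 Thm. 2.49 (uniqueness of invariant measures on `G ⧸ H`).
* [Gelbart1975] S. Gelbart, Ann. of Math. Stud. 83 (1975), p. 155 (10.19) (orbital integrals factor over places).
* [Rogawski1990] J. D. Rogawski, Ann. of Math. Stud. 123 (1990), §4.3 p. 43, §4.9 Prop. 4.9.1 (a) p. 55, §14.3 p. 234 (`H_∞`, compatible measures, the archimedean transfer).
-/

set_option autoImplicit false

noncomputable section

open MeasureTheory MeasureTheory.Measure NumberField NumberField.InfinitePlace NumberField.mixedEmbedding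
open Literature.MeasureTheory.Group
open Literature.NumberTheory.Automorphic Literature.NumberTheory.Automorphic.UnitaryGroup
open scoped ENNReal NNReal MatrixGroups Classical ComplexOrder

namespace Literature.NumberTheory.Rogawski1990

/-! ## §0 Finite-product glue (private; = ★ `InvariantQuotientOrbitalPi` by name, whose olean is not served — see the header) -/

section PiGlue

variable {ι : Type*} {Gi : ι → Type*} [∀ i, Group (Gi i)] {G : Type*} [Group G]

/-- In a product of groups the centraliser of `(γ_i)` is the product of the centralisers (= ★ `centralizer_singleton_pi_eq`). [folklore] -/
private theorem centralizer_singleton_pi_eq' (γ : ∀ i, Gi i) :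
    Subgroup.centralizer ({γ} : Set (∀ i, Gi i)) = Subgroup.pi Set.univ fun i => Subgroup.centralizer ({γ i} : Set (Gi i)) := by
  ext p
  simp only [Subgroup.mem_centralizer_iff, Set.mem_singleton_iff, forall_eq, Subgroup.mem_pi, Set.mem_univ, true_imp_iff]
  exact ⟨fun h i => congrFun h i, fun h => funext h⟩

/-- `C(γ) = e(Π C(γ_i))` for `γ = e (γ_i)`: the compatibility hypothesis of ★ `cosetCongr e` (= ★ `forall_apply_mem_centralizer_pi_iff`). [cite: Gelbart1975, p. 155 (10.19)] -/
private theorem forall_apply_mem_centralizer_pi_iff' (e : (∀ i, Gi i) ≃* G) {γ : G} {γi : ∀ i, Gi i} (hγ : e γi = γ) :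
    ∀ p : ∀ i, Gi i, e p ∈ Subgroup.centralizer ({γ} : Set G) ↔
      p ∈ Subgroup.pi Set.univ fun i => Subgroup.centralizer ({γi i} : Set (Gi i)) := by
  intro p
  rw [← centralizer_singleton_pi_eq', ← mulEquiv_apply_mem_centralizer_singleton_iff e, hγ]

/-- The orbital integrand of `Φ = ⊗ ξ_i` in product coordinates is `∏_i ξ_i(a_i γ_i a_i⁻¹)` (= ★ `descConj_cosetCongr_quotientPiEquiv_symm`). [cite: Gelbart1975, p. 155 (10.19)] -/
private theorem descConj_cosetCongr_quotientPiEquiv_symm' [Fintype ι] {M : Type*} [CommMonoid M] (e : (∀ i, Gi i) ≃* G)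
    {γ : G} {γi : ∀ i, Gi i} (hγ : e γi = γ) (Φ : G → M) (ξ : ∀ i, Gi i → M)
    (hΦ : ∀ a : ∀ i, Gi i, Φ (e a) = ∏ i, ξ i (a i))
    (x : ∀ i, Gi i ⧸ Subgroup.centralizer ({γi i} : Set (Gi i))) :
    descConj γ (Subgroup.centralizer ({γ} : Set G)) (centralizer_comm γ) Φ
        (cosetCongr e _ _ (forall_apply_mem_centralizer_pi_iff' e hγ) ((quotientPiEquiv _).symm x)) =
      ∏ i, descConj (γi i) _ (centralizer_comm _) (ξ i) (x i) := by
  have hx : x = fun i => (QuotientGroup.mk (x i).out : Gi i ⧸ Subgroup.centralizer ({γi i} : Set (Gi i))) :=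
    funext fun i => (QuotientGroup.out_eq' (x i)).symm
  rw [hx, quotientPiEquiv_symm_mk, cosetCongr_mk, descConj_mk, ← hγ, ← map_mul, ← map_inv, ← map_mul, hΦ]
  refine Finset.prod_congr rfl fun i _ => ?_
  rw [descConj_mk]
  rfl

variable [Fintype ι] [∀ i, TopologicalSpace (Gi i)] [∀ i, IsTopologicalGroup (Gi i)] [∀ i, LocallyCompactSpace (Gi i)]
  [∀ i, SecondCountableTopology (Gi i)] [∀ i, T2Space (Gi i)] [TopologicalSpace G]

/-- The invariant measure of `G ⧸ C(γ)` in product coordinates: transported to `(Π G_i) ⧸ (Π C(γ_i))` along `cosetCongr e⁻¹`, a non-zero invariant `μ` finite on compact sets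
is `c • (⊠ μ_i)`, `c ≠ 0` (= ★ `exists_map_cosetCongr_eq_smul_map_symm_pi`, over ★ `exists_eq_smul_map_symm_pi`). [cite: Folland1995, Thm. 2.49] [cite: Gelbart1975, p. 155 (10.19)] -/
private theorem exists_map_cosetCongr_eq_smul_map_symm_pi'
    (e : (∀ i, Gi i) ≃* G) (he : Continuous e) (hes : Continuous e.symm) {γ : G} {γi : ∀ i, Gi i} (hγ : e γi = γ)
    (hC : ∀ i, IsClosed ((Subgroup.centralizer ({γi i} : Set (Gi i)) : Subgroup (Gi i)) : Set (Gi i)))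
    [MeasurableSpace (G ⧸ Subgroup.centralizer ({γ} : Set G))] [BorelSpace (G ⧸ Subgroup.centralizer ({γ} : Set G))]
    [∀ i, MeasurableSpace (Gi i ⧸ Subgroup.centralizer ({γi i} : Set (Gi i)))]
    [∀ i, BorelSpace (Gi i ⧸ Subgroup.centralizer ({γi i} : Set (Gi i)))]
    (μ : Measure (G ⧸ Subgroup.centralizer ({γ} : Set G)))
    [SMulInvariantMeasure G (G ⧸ Subgroup.centralizer ({γ} : Set G)) μ] [IsFiniteMeasureOnCompacts μ]
    (μi : ∀ i, Measure (Gi i ⧸ Subgroup.centralizer ({γi i} : Set (Gi i))))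
    [∀ i, SMulInvariantMeasure (Gi i) (Gi i ⧸ Subgroup.centralizer ({γi i} : Set (Gi i))) (μi i)]
    [∀ i, IsFiniteMeasureOnCompacts (μi i)] [∀ i, SigmaFinite (μi i)]
    (hμ : μ ≠ 0) (h : ∀ i, μi i ≠ 0)
    [MeasurableSpace ((∀ i, Gi i) ⧸ Subgroup.pi Set.univ fun i => Subgroup.centralizer ({γi i} : Set (Gi i)))]
    [BorelSpace ((∀ i, Gi i) ⧸ Subgroup.pi Set.univ fun i => Subgroup.centralizer ({γi i} : Set (Gi i)))] :
    ∃ c : ℝ≥0, c ≠ 0 ∧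
      Measure.map (cosetCongr e.symm (Subgroup.centralizer ({γ} : Set G)) _
          (forall_symm_mem_iff e _ _ (forall_apply_mem_centralizer_pi_iff' e hγ))) μ =
        c • (Measure.pi μi).map (quotientPiHomeomorph _).symm := by
  haveI := smulInvariantMeasure_map_cosetCongr_of_smulInvariant e.symm hes
    (Subgroup.centralizer ({γ} : Set G)) _ (forall_symm_mem_iff e _ _ (forall_apply_mem_centralizer_pi_iff' e hγ)) μ
  have hhomeo : Measure.map (cosetCongr e.symm (Subgroup.centralizer ({γ} : Set G)) _
      (forall_symm_mem_iff e _ _ (forall_apply_mem_centralizer_pi_iff' e hγ))) μ =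
      Measure.map (cosetCongrHomeomorph e _ _ (forall_apply_mem_centralizer_pi_iff' e hγ) he hes).symm μ := rfl
  haveI : IsFiniteMeasureOnCompacts (Measure.map (cosetCongr e.symm (Subgroup.centralizer ({γ} : Set G)) _
      (forall_symm_mem_iff e _ _ (forall_apply_mem_centralizer_pi_iff' e hγ))) μ) := by
    rw [hhomeo]
    exact IsFiniteMeasureOnCompacts.map μ _
  have hne : Measure.map (cosetCongr e.symm (Subgroup.centralizer ({γ} : Set G)) _
      (forall_symm_mem_iff e _ _ (forall_apply_mem_centralizer_pi_iff' e hγ))) μ ≠ 0 := by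
    rw [hhomeo, Ne, Measure.map_eq_zero_iff (Homeomorph.measurable _).aemeasurable]
    exact hμ
  exact exists_eq_smul_map_symm_pi _ hC μi h _ hne

end PiGlue

/-! ## §1 The abstract finite-product step -/

section PiStep

variable {ι : Type*} [Fintype ι] {Gi : ι → Type*} [∀ i, Group (Gi i)] [∀ i, TopologicalSpace (Gi i)]
  [∀ i, IsTopologicalGroup (Gi i)] [∀ i, LocallyCompactSpace (Gi i)] [∀ i, SecondCountableTopology (Gi i)]
  [∀ i, T2Space (Gi i)]
  {G : Type*} [Group G] [TopologicalSpace G]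

/-- **«Places multiply» on the quotient, abstract finite-product step.**  For a bicontinuous `e : (Π_i G_i) ≃* G`, `γ = e (γ_i)`, ANY `G`-invariant measure `μ` on
`G ⧸ C(γ)` finite on compact sets, ANY non-zero invariant σ-finite `μ_i` on `G_i ⧸ C(γ_i)` finite on compact sets, functions `f_i ≥ 1` with
`μ_i{ā ∣ f_i(ā γ_i ā⁻¹) ≤ ρ} ≤ C_i ρ^a` (`ρ ≥ 1`, `a ≥ 0`) and `Φ(e(a)) = ∏_i f_i(a_i)`: `μ{ȳ ∣ Φ(ȳ γ ȳ⁻¹) ≤ R} ≤ A R^a (1 + log R)^m` for `R ≥ 1`.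
(Uniqueness ★ `exists_map_cosetCongr_eq_smul_map_symm_pi`: `μ ↦ c • ⨂ μ_i`; ★ `descConj_cosetCongr_quotientPiEquiv_symm`; dyadic boxes ★ `exists_pi_measure_setOf_prod_le_of_marginal_growth`.)
[cite: Folland1995, §2.6 Thm. 2.49] [cite: Gelbart1975, p. 155 (10.19)] [cite: BeuzartPlessis2020Asterisque, §1.5 (1.5.2) p. 31] -/
theorem measure_setOf_descConj_le_of_pi_marginal_growth
    (e : (∀ i, Gi i) ≃* G) (he : Continuous e) (hes : Continuous e.symm) {γ : G} {γi : ∀ i, Gi i} (hγ : e γi = γ)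
    [MeasurableSpace (G ⧸ Subgroup.centralizer ({γ} : Set G))] [BorelSpace (G ⧸ Subgroup.centralizer ({γ} : Set G))]
    [∀ i, MeasurableSpace (Gi i ⧸ Subgroup.centralizer ({γi i} : Set (Gi i)))]
    [∀ i, BorelSpace (Gi i ⧸ Subgroup.centralizer ({γi i} : Set (Gi i)))]
    (μ : Measure (G ⧸ Subgroup.centralizer ({γ} : Set G)))
    [SMulInvariantMeasure G (G ⧸ Subgroup.centralizer ({γ} : Set G)) μ] [IsFiniteMeasureOnCompacts μ]
    (μi : ∀ i, Measure (Gi i ⧸ Subgroup.centralizer ({γi i} : Set (Gi i))))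
    [∀ i, SMulInvariantMeasure (Gi i) (Gi i ⧸ Subgroup.centralizer ({γi i} : Set (Gi i))) (μi i)]
    [∀ i, IsFiniteMeasureOnCompacts (μi i)] [∀ i, SigmaFinite (μi i)] (hμi : ∀ i, μi i ≠ 0)
    {Φ : G → ℝ} {f : ∀ i, Gi i → ℝ} (hΦ : ∀ a, Φ (e a) = ∏ i, f i (a i)) (hf1 : ∀ i x, 1 ≤ f i x)
    {a : ℝ} (ha : 0 ≤ a)
    (hgrowth : ∀ i, ∃ C : ℝ, ∀ ρ : ℝ, 1 ≤ ρ →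
      μi i {x | descConj (γi i) _ (centralizer_comm (γi i)) (f i) x ≤ ρ} ≤ ENNReal.ofReal (C * ρ ^ a)) :
    ∃ (A : ℝ) (m : ℕ), ∀ R : ℝ, 1 ≤ R →
      μ {x | descConj γ _ (centralizer_comm γ) Φ x ≤ R} ≤ ENNReal.ofReal (A * R ^ a * (1 + Real.log R) ^ m) := by
  classical
  -- closed centralisers of the components
  have hC : ∀ i, IsClosed ((Subgroup.centralizer ({γi i} : Set (Gi i)) : Subgroup (Gi i)) : Set (Gi i)) := fun i =>
    Set.isClosed_centralizer ({γi i} : Set (Gi i))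
  -- the dyadic-box bound for `⨂ μ_i` on the product of the place quotients
  obtain ⟨A, m, hA0, hA⟩ := exists_pi_measure_setOf_prod_le_of_marginal_growth μi
    (f := fun i => descConj (γi i) _ (centralizer_comm (γi i)) (f i))
    (fun i x => by
      induction x using QuotientGroup.induction_on with
      | H y => rw [descConj_mk]; exact hf1 i _) ha hgrowth
  by_cases hμ : μ = 0
  · exact ⟨0, 0, fun R _ => by simp [hμ]⟩
  -- Borel structure on the model quotient `(Π G_i) ⧸ (Π C(γ_i))`
  letI : MeasurableSpace ((∀ i, Gi i) ⧸ Subgroup.pi Set.univ fun i => Subgroup.centralizer ({γi i} : Set (Gi i))) := borel _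
  haveI : BorelSpace ((∀ i, Gi i) ⧸ Subgroup.pi Set.univ fun i => Subgroup.centralizer ({γi i} : Set (Gi i))) := ⟨rfl⟩
  obtain ⟨c, -, hc⟩ := exists_map_cosetCongr_eq_smul_map_symm_pi' e he hes hγ hC μ μi hμ hμi
  refine ⟨(c : ℝ) * A, m, fun R hR => ?_⟩
  -- abbreviations
  have hHH' := forall_apply_mem_centralizer_pi_iff' e hγ
  set φ := cosetCongr e.symm (Subgroup.centralizer ({γ} : Set G)) _ (forall_symm_mem_iff e _ _ hHH') with hφdef
  set T : Set ((∀ i, Gi i) ⧸ Subgroup.pi Set.univ fun i => Subgroup.centralizer ({γi i} : Set (Gi i))) :=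
    {y | descConj γ _ (centralizer_comm γ) Φ (cosetCongr e _ _ hHH' y) ≤ R} with hT
  -- the ball is the preimage of the model ball
  have hS : {x | descConj γ _ (centralizer_comm γ) Φ x ≤ R} = φ ⁻¹' T := by
    ext x
    simp only [hT, Set.mem_setOf_eq, Set.mem_preimage, hφdef, cosetCongr_apply_symm]
  have hφm : Measurable φ := (continuous_cosetCongr e.symm _ _ _ hes).measurable
  -- the model ball in product coordinates
  have hpre : (quotientPiHomeomorph fun i => Subgroup.centralizer ({γi i} : Set (Gi i))).symm ⁻¹' T =
      {p | ∏ i, descConj (γi i) _ (centralizer_comm (γi i)) (f i) (p i) ≤ R} := by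
    ext p
    simp only [hT, Set.mem_preimage, Set.mem_setOf_eq, coe_quotientPiHomeomorph_symm,
      descConj_cosetCongr_quotientPiEquiv_symm' e hγ Φ f hΦ p]
  have hX0 : 0 ≤ A * R ^ a * (1 + Real.log R) ^ m :=
    mul_nonneg (mul_nonneg hA0 (Real.rpow_nonneg (zero_le_one.trans hR) a)) (pow_nonneg (by linarith [Real.log_nonneg hR]) m)
  calc μ {x | descConj γ _ (centralizer_comm γ) Φ x ≤ R} = μ (φ ⁻¹' T) := by rw [hS]
    _ ≤ Measure.map φ μ T := Measure.le_map_apply hφm.aemeasurable T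
    _ = (c • (Measure.pi μi).map (quotientPiHomeomorph _).symm) T := by rw [hc]
    _ = c * (Measure.pi μi) ((quotientPiHomeomorph fun i => Subgroup.centralizer ({γi i} : Set (Gi i))).symm ⁻¹' T) := by
        rw [Measure.coe_nnreal_smul_apply, ← Homeomorph.toMeasurableEquiv_coe, MeasurableEquiv.map_apply]
    _ ≤ c * ENNReal.ofReal (A * R ^ a * (1 + Real.log R) ^ m) := by
        rw [hpre]
        gcongr
        exact hA R hR
    _ = ENNReal.ofReal ((c : ℝ) * A * R ^ a * (1 + Real.log R) ^ m) := by
        rw [ENNReal.ofReal_coe_nnreal.symm, ← ENNReal.ofReal_mul (NNReal.coe_nonneg _)]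
        congr 1
        ring

end PiStep

/-! ## §2 The abstract compact-factor step -/

section CompactStep

/-- The image of a left-invariant measure under `G → G ⧸ H` is a `G`-invariant measure on the coset space. [folklore] [cite: Folland1995, §2.6] -/
theorem smulInvariantMeasure_map_mk_of_isMulLeftInvariant {G : Type*} [Group G] [TopologicalSpace G] [IsTopologicalGroup G]
    [MeasurableSpace G] [BorelSpace G] (H : Subgroup G) [MeasurableSpace (G ⧸ H)] [BorelSpace (G ⧸ H)]
    (ν : Measure G) [ν.IsMulLeftInvariant] :
    SMulInvariantMeasure G (G ⧸ H) (Measure.map (QuotientGroup.mk : G → G ⧸ H) ν) := by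
  refine ⟨fun g S hS => ?_⟩
  have hm : Measurable (QuotientGroup.mk : G → G ⧸ H) := continuous_quotient_mk'.measurable
  rw [Measure.map_apply hm hS, Measure.map_apply hm (hS.preimage (measurable_const_smul g))]
  have h1 : (QuotientGroup.mk : G → G ⧸ H) ⁻¹' ((fun x : G ⧸ H => g • x) ⁻¹' S) =
      (fun y : G => g * y) ⁻¹' ((QuotientGroup.mk : G → G ⧸ H) ⁻¹' S) := by
    ext y
    simp only [Set.mem_preimage, MulAction.Quotient.smul_mk, smul_eq_mul]
  rw [h1, measure_preimage_mul]

variable {G₁ G₂ G : Type*} [Group G₁] [TopologicalSpace G₁] [IsTopologicalGroup G₁] [LocallyCompactSpace G₁]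
  [SecondCountableTopology G₁] [T2Space G₁]
  [Group G₂] [TopologicalSpace G₂] [IsTopologicalGroup G₂] [CompactSpace G₂] [SecondCountableTopology G₂] [T2Space G₂]
  [Group G] [TopologicalSpace G]

/-- **«Places multiply» on the quotient, abstract compact-factor step.**  For a bicontinuous `e : G₁ × G₂ ≃* G` with `G₂` COMPACT, `γ = e(γ₁, γ₂)`, ANY
`G`-invariant measure `μ` on `G ⧸ C(γ)` finite on compact sets, ANY non-zero invariant s-finite `μ₁` on `G₁ ⧸ C(γ₁)` finite on compact sets, and `Φ(e(a, k)) = ξ(a)`: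
a bound `μ₁{ā ∣ ξ(ā γ₁ ā⁻¹) ≤ R} ≤ A R^a (1 + log R)^m` (`R ≥ 1`) gives `μ{ȳ ∣ Φ(ȳ γ ȳ⁻¹) ≤ R} ≤ A′ R^a (1 + log R)^m`.  (Uniqueness ★
`exists_map_cosetCongr_eq_smul_map_symm_prod` against `μ₁ ⊗ μ₂`, `μ₂ = ` the image of a Haar measure of the compact `G₂` on `G₂ ⧸ C(γ₂)`, of finite mass;
★ `descConj_cosetCongr_prodEquiv_symm`.) [cite: Folland1995, §2.6 Thm. 2.49] [cite: Gelbart1975, p. 155 (10.19)] [cite: BeuzartPlessis2020Asterisque, §1.5 (1.5.2) p. 31] -/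
theorem measure_setOf_descConj_le_of_prod_compactSpace
    (e : G₁ × G₂ ≃* G) (he : Continuous e) (hes : Continuous e.symm) {γ : G} {γ₁ : G₁} {γ₂ : G₂} (hγ : e (γ₁, γ₂) = γ)
    [MeasurableSpace (G ⧸ Subgroup.centralizer ({γ} : Set G))] [BorelSpace (G ⧸ Subgroup.centralizer ({γ} : Set G))]
    [MeasurableSpace (G₁ ⧸ Subgroup.centralizer ({γ₁} : Set G₁))] [BorelSpace (G₁ ⧸ Subgroup.centralizer ({γ₁} : Set G₁))]
    (μ : Measure (G ⧸ Subgroup.centralizer ({γ} : Set G)))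
    [SMulInvariantMeasure G (G ⧸ Subgroup.centralizer ({γ} : Set G)) μ] [IsFiniteMeasureOnCompacts μ]
    (μ₁ : Measure (G₁ ⧸ Subgroup.centralizer ({γ₁} : Set G₁)))
    [SMulInvariantMeasure G₁ (G₁ ⧸ Subgroup.centralizer ({γ₁} : Set G₁)) μ₁] [IsFiniteMeasureOnCompacts μ₁] [SFinite μ₁]
    (hμ₁ : μ₁ ≠ 0)
    {Φ : G → ℝ} {ξ : G₁ → ℝ} (hΦ : ∀ a k, Φ (e (a, k)) = ξ a) {a : ℝ}
    (hgrowth : ∃ (A : ℝ) (m : ℕ), ∀ R : ℝ, 1 ≤ R →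
      μ₁ {x | descConj γ₁ _ (centralizer_comm γ₁) ξ x ≤ R} ≤ ENNReal.ofReal (A * R ^ a * (1 + Real.log R) ^ m)) :
    ∃ (A : ℝ) (m : ℕ), ∀ R : ℝ, 1 ≤ R →
      μ {x | descConj γ _ (centralizer_comm γ) Φ x ≤ R} ≤ ENNReal.ofReal (A * R ^ a * (1 + Real.log R) ^ m) := by
  classical
  obtain ⟨A, m, hA⟩ := hgrowth
  by_cases hμ : μ = 0
  · exact ⟨0, 0, fun R _ => by simp [hμ]⟩
  -- closed centralisers
  have hC₁ : IsClosed ((Subgroup.centralizer ({γ₁} : Set G₁) : Subgroup G₁) : Set G₁) := Set.isClosed_centralizer ({γ₁} : Set G₁)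
  have hC₂ : IsClosed ((Subgroup.centralizer ({γ₂} : Set G₂) : Subgroup G₂) : Set G₂) := Set.isClosed_centralizer ({γ₂} : Set G₂)
  -- Borel structures on `G₂`, `G₂ ⧸ C(γ₂)` and the model quotient
  letI : MeasurableSpace G₂ := borel G₂
  haveI : BorelSpace G₂ := ⟨rfl⟩
  letI : MeasurableSpace (G₂ ⧸ Subgroup.centralizer ({γ₂} : Set G₂)) := borel _
  haveI : BorelSpace (G₂ ⧸ Subgroup.centralizer ({γ₂} : Set G₂)) := ⟨rfl⟩
  letI : MeasurableSpace ((G₁ × G₂) ⧸ (Subgroup.centralizer ({γ₁} : Set G₁)).prod (Subgroup.centralizer ({γ₂} : Set G₂))) := borel _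
  haveI : BorelSpace ((G₁ × G₂) ⧸ (Subgroup.centralizer ({γ₁} : Set G₁)).prod (Subgroup.centralizer ({γ₂} : Set G₂))) := ⟨rfl⟩
  -- the finite invariant measure on the compact factor
  set μ₂ : Measure (G₂ ⧸ Subgroup.centralizer ({γ₂} : Set G₂)) :=
    Measure.map (QuotientGroup.mk : G₂ → G₂ ⧸ Subgroup.centralizer ({γ₂} : Set G₂)) Measure.haar with hμ₂
  haveI : SMulInvariantMeasure G₂ (G₂ ⧸ Subgroup.centralizer ({γ₂} : Set G₂)) μ₂ :=
    smulInvariantMeasure_map_mk_of_isMulLeftInvariant _ _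
  haveI : IsFiniteMeasure (Measure.haar : Measure G₂) := CompactSpace.isFiniteMeasure
  haveI : IsFiniteMeasure μ₂ := Measure.isFiniteMeasure_map _ _
  have hm2 : Measurable (QuotientGroup.mk : G₂ → G₂ ⧸ Subgroup.centralizer ({γ₂} : Set G₂)) := continuous_quotient_mk'.measurable
  have hμ₂univ : μ₂ Set.univ = Measure.haar (Set.univ : Set G₂) := by
    rw [hμ₂, Measure.map_apply hm2 MeasurableSet.univ, Set.preimage_univ]
  have hμ₂0 : μ₂ ≠ 0 := by
    intro h0
    have h1 : μ₂ Set.univ = 0 := by rw [h0]; rfl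
    rw [hμ₂univ] at h1
    exact (NeZero.ne (Measure.haar (Set.univ : Set G₂))) h1
  have hfin : μ₂ Set.univ ≠ ⊤ := measure_ne_top μ₂ _
  -- uniqueness: `μ ↦ c • (μ₁ ⊗ μ₂)`
  obtain ⟨c, -, hc⟩ := exists_map_cosetCongr_eq_smul_map_symm_prod e he hes hγ hC₁ hC₂ μ μ₁ μ₂ hμ hμ₁ hμ₂0
  refine ⟨(c : ℝ) * (μ₂ Set.univ).toReal * A, m, fun R hR => ?_⟩
  have hHH' := forall_apply_mem_centralizer_iff e hγ
  set φ := cosetCongr e.symm (Subgroup.centralizer ({γ} : Set G)) _ (forall_symm_mem_iff e _ _ hHH') with hφdef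
  set T : Set ((G₁ × G₂) ⧸ (Subgroup.centralizer ({γ₁} : Set G₁)).prod (Subgroup.centralizer ({γ₂} : Set G₂))) :=
    {y | descConj γ _ (centralizer_comm γ) Φ (cosetCongr e _ _ hHH' y) ≤ R} with hT
  have hS : {x | descConj γ _ (centralizer_comm γ) Φ x ≤ R} = φ ⁻¹' T := by
    ext x
    simp only [hT, Set.mem_setOf_eq, Set.mem_preimage, hφdef, cosetCongr_apply_symm]
  have hφm : Measurable φ := (continuous_cosetCongr e.symm _ _ _ hes).measurable
  -- the model ball in product coordinates is `T₁ ×ˢ univ`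
  have hpre : (quotientProdHomeomorph (Subgroup.centralizer ({γ₁} : Set G₁)) (Subgroup.centralizer ({γ₂} : Set G₂))).symm ⁻¹' T =
      {x | descConj γ₁ _ (centralizer_comm γ₁) ξ x ≤ R} ×ˢ (Set.univ : Set (G₂ ⧸ Subgroup.centralizer ({γ₂} : Set G₂))) := by
    ext ⟨x₁, x₂⟩
    have h2 : descConj γ₂ _ (centralizer_comm γ₂) (fun _ : G₂ => (1 : ℝ)) x₂ = 1 := by
      induction x₂ using QuotientGroup.induction_on with
      | H k => rw [descConj_mk]
    simp only [hT, Set.mem_preimage, Set.mem_setOf_eq, coe_quotientProdHomeomorph_symm, Set.mem_prod, Set.mem_univ, and_true,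
      descConj_cosetCongr_prodEquiv_symm e hγ Φ ξ (fun _ => (1 : ℝ)) (fun a k => by rw [hΦ, mul_one]) x₁ x₂, h2, mul_one]
  set t : ℝ := (μ₂ Set.univ).toReal with htdef
  have ht : μ₂ Set.univ = ENNReal.ofReal t := (ENNReal.ofReal_toReal hfin).symm
  calc μ {x | descConj γ _ (centralizer_comm γ) Φ x ≤ R} = μ (φ ⁻¹' T) := by rw [hS]
    _ ≤ Measure.map φ μ T := Measure.le_map_apply hφm.aemeasurable T
    _ = (c • (μ₁.prod μ₂).map (quotientProdHomeomorph _ _).symm) T := by rw [hc]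
    _ = c * (μ₁.prod μ₂) ((quotientProdHomeomorph (Subgroup.centralizer ({γ₁} : Set G₁)) (Subgroup.centralizer ({γ₂} : Set G₂))).symm ⁻¹' T) := by
        rw [Measure.coe_nnreal_smul_apply, ← Homeomorph.toMeasurableEquiv_coe, MeasurableEquiv.map_apply]
    _ = c * (μ₁ {x | descConj γ₁ _ (centralizer_comm γ₁) ξ x ≤ R} * μ₂ Set.univ) := by rw [hpre, Measure.prod_prod]
    _ ≤ c * (ENNReal.ofReal (A * R ^ a * (1 + Real.log R) ^ m) * μ₂ Set.univ) := by
        gcongr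
        exact hA R hR
    _ = ENNReal.ofReal ((c : ℝ) * t * A * R ^ a * (1 + Real.log R) ^ m) := by
        by_cases hX : 0 ≤ A * R ^ a * (1 + Real.log R) ^ m
        · rw [ht, ENNReal.ofReal_coe_nnreal.symm, ← ENNReal.ofReal_mul hX, ← ENNReal.ofReal_mul (NNReal.coe_nonneg _)]
          congr 1
          ring
        · push Not at hX
          have h0 : ENNReal.ofReal (A * R ^ a * (1 + Real.log R) ^ m) = 0 := ENNReal.ofReal_of_nonpos hX.le
          have h0' : (c : ℝ) * t * A * R ^ a * (1 + Real.log R) ^ m ≤ 0 := by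
            have : (c : ℝ) * t * A * R ^ a * (1 + Real.log R) ^ m = ((c : ℝ) * t) * (A * R ^ a * (1 + Real.log R) ^ m) := by ring
            rw [this]
            exact mul_nonpos_of_nonneg_of_nonpos (mul_nonneg (NNReal.coe_nonneg _) ENNReal.toReal_nonneg) hX.le
          rw [h0, zero_mul, mul_zero, ENNReal.ofReal_of_nonpos h0']
    _ = ENNReal.ofReal ((c : ℝ) * (μ₂ Set.univ).toReal * A * R ^ a * (1 + Real.log R) ^ m) := by rw [htdef]

end CompactStep

/-! ## §3 The frame `(Π_i G_i) × G₂ ≃* G` (= §2 ∘ §1) -/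

section PiProdStep

variable {ι : Type*} [Fintype ι] {Gi : ι → Type*} [∀ i, Group (Gi i)] [∀ i, TopologicalSpace (Gi i)]
  [∀ i, IsTopologicalGroup (Gi i)] [∀ i, LocallyCompactSpace (Gi i)] [∀ i, SecondCountableTopology (Gi i)]
  [∀ i, T2Space (Gi i)]
  {G₂ : Type*} [Group G₂] [TopologicalSpace G₂] [IsTopologicalGroup G₂] [CompactSpace G₂] [SecondCountableTopology G₂] [T2Space G₂]
  {G : Type*} [Group G] [TopologicalSpace G]

/-- **«Places multiply» on the quotient, frame `e : (Π_i G_i) × G₂ ≃* G` with `G₂` compact** (the frame of ★ `lintegral_descConj_quotientMeasure_eq_prod_mul`):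
for `γ = e((γ_i), γ₂)`, ANY `G`-invariant `μ` on `G ⧸ C(γ)` finite on compact sets, ANY non-zero invariant σ-finite `μ_i` on `G_i ⧸ C(γ_i)` finite on compact sets,
`f_i ≥ 1` with `μ_i{ā ∣ f_i(ā γ_i ā⁻¹) ≤ ρ} ≤ C_i ρ^a` (`ρ ≥ 1`, `a ≥ 0`) and `Φ(e((a_i), k)) = ∏_i f_i(a_i)`:
`μ{ȳ ∣ Φ(ȳ γ ȳ⁻¹) ≤ R} ≤ A R^a (1 + log R)^m` for `R ≥ 1`. [cite: Folland1995, §2.6 Thm. 2.49] [cite: Gelbart1975, p. 155 (10.19)]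
[cite: BeuzartPlessis2020Asterisque, §1.5 (1.5.2) p. 31] -/
theorem measure_setOf_descConj_le_of_piProd_marginal_growth
    (e : (∀ i, Gi i) × G₂ ≃* G) (he : Continuous e) (hes : Continuous e.symm)
    {γ : G} {γi : ∀ i, Gi i} {γ₂ : G₂} (hγ : e (γi, γ₂) = γ)
    [MeasurableSpace (G ⧸ Subgroup.centralizer ({γ} : Set G))] [BorelSpace (G ⧸ Subgroup.centralizer ({γ} : Set G))]
    [∀ i, MeasurableSpace (Gi i ⧸ Subgroup.centralizer ({γi i} : Set (Gi i)))]
    [∀ i, BorelSpace (Gi i ⧸ Subgroup.centralizer ({γi i} : Set (Gi i)))]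
    (μ : Measure (G ⧸ Subgroup.centralizer ({γ} : Set G)))
    [SMulInvariantMeasure G (G ⧸ Subgroup.centralizer ({γ} : Set G)) μ] [IsFiniteMeasureOnCompacts μ]
    (μi : ∀ i, Measure (Gi i ⧸ Subgroup.centralizer ({γi i} : Set (Gi i))))
    [∀ i, SMulInvariantMeasure (Gi i) (Gi i ⧸ Subgroup.centralizer ({γi i} : Set (Gi i))) (μi i)]
    [∀ i, IsFiniteMeasureOnCompacts (μi i)] [∀ i, SigmaFinite (μi i)] (hμi : ∀ i, μi i ≠ 0)
    {Φ : G → ℝ} {f : ∀ i, Gi i → ℝ} (hΦ : ∀ a k, Φ (e (a, k)) = ∏ i, f i (a i)) (hf1 : ∀ i x, 1 ≤ f i x)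
    {a : ℝ} (ha : 0 ≤ a)
    (hgrowth : ∀ i, ∃ C : ℝ, ∀ ρ : ℝ, 1 ≤ ρ →
      μi i {x | descConj (γi i) _ (centralizer_comm (γi i)) (f i) x ≤ ρ} ≤ ENNReal.ofReal (C * ρ ^ a)) :
    ∃ (A : ℝ) (m : ℕ), ∀ R : ℝ, 1 ≤ R →
      μ {x | descConj γ _ (centralizer_comm γ) Φ x ≤ R} ≤ ENNReal.ofReal (A * R ^ a * (1 + Real.log R) ^ m) := by
  classical
  have hC : ∀ i, IsClosed ((Subgroup.centralizer ({γi i} : Set (Gi i)) : Subgroup (Gi i)) : Set (Gi i)) := fun i =>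
    Set.isClosed_centralizer ({γi i} : Set (Gi i))
  haveI : ∀ i, IsClosed ((Subgroup.centralizer ({γi i} : Set (Gi i)) : Subgroup (Gi i)) : Set (Gi i)) := hC
  haveI : ∀ i, SecondCountableTopology (Gi i ⧸ Subgroup.centralizer ({γi i} : Set (Gi i))) := fun i => inferInstance
  -- Borel structures on the two model quotients of `Π G_i`
  letI : MeasurableSpace ((∀ i, Gi i) ⧸ Subgroup.pi Set.univ fun i => Subgroup.centralizer ({γi i} : Set (Gi i))) := borel _
  haveI : BorelSpace ((∀ i, Gi i) ⧸ Subgroup.pi Set.univ fun i => Subgroup.centralizer ({γi i} : Set (Gi i))) := ⟨rfl⟩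
  letI : MeasurableSpace ((∀ i, Gi i) ⧸ Subgroup.centralizer ({γi} : Set (∀ i, Gi i))) := borel _
  haveI : BorelSpace ((∀ i, Gi i) ⧸ Subgroup.centralizer ({γi} : Set (∀ i, Gi i))) := ⟨rfl⟩
  -- the transported product `ν₁ = (⨂ μ_i)` read on `(Π G_i) ⧸ C((γ_i))`
  have hrefl : ∀ p : ∀ i, Gi i, (MulEquiv.refl (∀ i, Gi i)) p ∈ Subgroup.centralizer ({γi} : Set (∀ i, Gi i)) ↔
      p ∈ Subgroup.pi Set.univ fun i => Subgroup.centralizer ({γi i} : Set (Gi i)) := fun p => by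
    rw [MulEquiv.refl_apply, centralizer_singleton_pi_eq']
  set P : Measure ((∀ i, Gi i) ⧸ Subgroup.pi Set.univ fun i => Subgroup.centralizer ({γi i} : Set (Gi i))) :=
    Measure.map (quotientPiHomeomorph fun i => Subgroup.centralizer ({γi i} : Set (Gi i))).symm (Measure.pi μi) with hP
  haveI : SMulInvariantMeasure (∀ i, Gi i) _ P := smulInvariantMeasure_map_symm_pi _ μi
  haveI : IsFiniteMeasureOnCompacts P := isFiniteMeasureOnCompacts_map_symm_pi _ μi
  have hP0 : P ≠ 0 := map_symm_pi_ne_zero _ μi hμi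
  set ψ := cosetCongrHomeomorph (MulEquiv.refl (∀ i, Gi i)) _ (Subgroup.centralizer ({γi} : Set (∀ i, Gi i))) hrefl
    continuous_id continuous_id with hψ
  set ν₁ : Measure ((∀ i, Gi i) ⧸ Subgroup.centralizer ({γi} : Set (∀ i, Gi i))) := Measure.map ψ P with hν₁
  have hν₁' : ν₁ = Measure.map (cosetCongr (MulEquiv.refl (∀ i, Gi i)) _ _ hrefl) P := rfl
  haveI : SMulInvariantMeasure (∀ i, Gi i) _ ν₁ := by
    rw [hν₁']
    exact smulInvariantMeasure_map_cosetCongr_of_smulInvariant (MulEquiv.refl (∀ i, Gi i)) continuous_id _ _ hrefl P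
  haveI : IsFiniteMeasureOnCompacts ν₁ := IsFiniteMeasureOnCompacts.map P ψ
  have hν₁0 : ν₁ ≠ 0 := by
    rw [hν₁, Ne, Measure.map_eq_zero_iff ψ.measurable.aemeasurable]
    exact hP0
  -- §1 on `Π G_i` itself (`e = id`) gives the growth of `ν₁`
  have h1 := measure_setOf_descConj_le_of_pi_marginal_growth (MulEquiv.refl (∀ i, Gi i)) continuous_id continuous_id
    (γ := γi) (γi := γi) rfl ν₁ μi hμi (Φ := fun a => ∏ i, f i (a i)) (f := f) (fun a => rfl) hf1 ha hgrowth
  -- §2 transports it to `G ⧸ C(γ)`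
  exact measure_setOf_descConj_le_of_prod_compactSpace e he hes hγ μ ν₁ hν₁0 (Φ := Φ) (ξ := fun a => ∏ i, f i (a i)) hΦ h1

end PiProdStep

/-! ## §4 The `H_∞` dress: any invariant measure on `H_∞ ⧸ Z(γ)`, per-place quotient growth -/

section HInfty

variable (L : Type) [Field L] [NumberField L] [IsCMField L]

/-- **«PLACES MULTIPLY» FOR ORBIT HS-BALLS ON `H_∞ ⧸ Z(γ)` (any invariant measure; the (h-piquot) token).**  Let `γ = (γ₂, γ₁) ∈ H_∞ = U(Φ₂)(L⁺ ⊗ ℝ) × U(Φ₁)(L⁺ ⊗ ℝ)`,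
`γ_w := (archPiEquivCM … γ₂)_w ∈ U(Φ₂)_w` its place components, `μ` ANY `H_∞`-invariant measure on `H_∞ ⧸ Z(γ)` finite on compact sets (e.g. the Weil-form quotient
`dν_H ∕ dt_H` of a (W_H) family), and for each complex place `w` let `μ_w` be ANY ONE non-zero `U(Φ₂)_w`-invariant σ-finite measure on `U(Φ₂)_w ⧸ Z_w(γ_w)` finite on
compact sets with `μ_w{ȳ ∣ F_w(ȳ γ_w ȳ⁻¹) ≤ ρ} ≤ C ρ^a` (`ρ ≥ 1`; `F_w ≥ 1`, `a ≥ 0`).  Then `μ{ȳ Z(γ) ∣ ∏_w F_w((ȳ γ ȳ⁻¹)_{2,w}) ≤ R} ≤ A R^a (1 + log R)^m` for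
`R ≥ 1` (§3 along `archPiEquivCM⁻¹ × id : (Π_w U(Φ₂)_w) × U(Φ₁)_∞ ≃* H_∞`; `U(Φ₁)_∞` is compact). [cite: BeuzartPlessis2020Asterisque, §1.5 (1.5.2) p. 31]
[cite: Folland1995, §2.6 Thm. 2.49] [cite: Rogawski1990, §4.3 p. 43; §14.3 p. 234] -/
theorem measure_setOf_descConj_prod_place_le_of_marginal_growth
    (γ : ↥(UnitaryGroup.arch (↥(maximalRealSubfield L)) L (IsCMField.complexConj L) 2 (Matrix.of fun i j : Fin 2 => if i.val + j.val + 1 = 2 then (1 : L) else 0)) ×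
      ↥(UnitaryGroup.arch (↥(maximalRealSubfield L)) L (IsCMField.complexConj L) 1 (Matrix.of fun i j : Fin 1 => if i.val + j.val + 1 = 1 then (1 : L) else 0)))
    [MeasurableSpace ((↥(UnitaryGroup.arch (↥(maximalRealSubfield L)) L (IsCMField.complexConj L) 2 (Matrix.of fun i j : Fin 2 => if i.val + j.val + 1 = 2 then (1 : L) else 0)) ×
      ↥(UnitaryGroup.arch (↥(maximalRealSubfield L)) L (IsCMField.complexConj L) 1 (Matrix.of fun i j : Fin 1 => if i.val + j.val + 1 = 1 then (1 : L) else 0))) ⧸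
        Subgroup.centralizer ({γ} : Set _))]
    [BorelSpace ((↥(UnitaryGroup.arch (↥(maximalRealSubfield L)) L (IsCMField.complexConj L) 2 (Matrix.of fun i j : Fin 2 => if i.val + j.val + 1 = 2 then (1 : L) else 0)) ×
      ↥(UnitaryGroup.arch (↥(maximalRealSubfield L)) L (IsCMField.complexConj L) 1 (Matrix.of fun i j : Fin 1 => if i.val + j.val + 1 = 1 then (1 : L) else 0))) ⧸
        Subgroup.centralizer ({γ} : Set _))]
    (μ : Measure ((↥(UnitaryGroup.arch (↥(maximalRealSubfield L)) L (IsCMField.complexConj L) 2 (Matrix.of fun i j : Fin 2 => if i.val + j.val + 1 = 2 then (1 : L) else 0)) ×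
      ↥(UnitaryGroup.arch (↥(maximalRealSubfield L)) L (IsCMField.complexConj L) 1 (Matrix.of fun i j : Fin 1 => if i.val + j.val + 1 = 1 then (1 : L) else 0))) ⧸
        Subgroup.centralizer ({γ} : Set _)))
    [SMulInvariantMeasure (↥(UnitaryGroup.arch (↥(maximalRealSubfield L)) L (IsCMField.complexConj L) 2 (Matrix.of fun i j : Fin 2 => if i.val + j.val + 1 = 2 then (1 : L) else 0)) ×
      ↥(UnitaryGroup.arch (↥(maximalRealSubfield L)) L (IsCMField.complexConj L) 1 (Matrix.of fun i j : Fin 1 => if i.val + j.val + 1 = 1 then (1 : L) else 0))) _ μ]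
    [IsFiniteMeasureOnCompacts μ]
    [∀ w : {w : InfinitePlace L // w.IsComplex}, MeasurableSpace (↥(archLocal L 2 (Matrix.of fun i j : Fin 2 => if i.val + j.val + 1 = 2 then (1 : L) else 0) w) ⧸
      Subgroup.centralizer ({archPiEquivCM 2 L (Matrix.of fun i j : Fin 2 => if i.val + j.val + 1 = 2 then (1 : L) else 0) γ.1 w} : Set _))]
    [∀ w : {w : InfinitePlace L // w.IsComplex}, BorelSpace (↥(archLocal L 2 (Matrix.of fun i j : Fin 2 => if i.val + j.val + 1 = 2 then (1 : L) else 0) w) ⧸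
      Subgroup.centralizer ({archPiEquivCM 2 L (Matrix.of fun i j : Fin 2 => if i.val + j.val + 1 = 2 then (1 : L) else 0) γ.1 w} : Set _))]
    (μw : ∀ w : {w : InfinitePlace L // w.IsComplex}, Measure (↥(archLocal L 2 (Matrix.of fun i j : Fin 2 => if i.val + j.val + 1 = 2 then (1 : L) else 0) w) ⧸
      Subgroup.centralizer ({archPiEquivCM 2 L (Matrix.of fun i j : Fin 2 => if i.val + j.val + 1 = 2 then (1 : L) else 0) γ.1 w} : Set _)))
    [∀ w, SMulInvariantMeasure (↥(archLocal L 2 (Matrix.of fun i j : Fin 2 => if i.val + j.val + 1 = 2 then (1 : L) else 0) w)) _ (μw w)]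
    [∀ w, IsFiniteMeasureOnCompacts (μw w)] [∀ w, SigmaFinite (μw w)] (hμw : ∀ w, μw w ≠ 0)
    (F : ∀ w : {w : InfinitePlace L // w.IsComplex}, ↥(archLocal L 2 (Matrix.of fun i j : Fin 2 => if i.val + j.val + 1 = 2 then (1 : L) else 0) w) → ℝ)
    (hF1 : ∀ w y, 1 ≤ F w y) {a : ℝ} (ha : 0 ≤ a)
    (hgrowth : ∀ w, ∃ C : ℝ, ∀ ρ : ℝ, 1 ≤ ρ →
      μw w {x | descConj (archPiEquivCM 2 L (Matrix.of fun i j : Fin 2 => if i.val + j.val + 1 = 2 then (1 : L) else 0) γ.1 w) _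
        (centralizer_comm _) (F w) x ≤ ρ} ≤ ENNReal.ofReal (C * ρ ^ a)) :
    ∃ (A : ℝ) (m : ℕ), ∀ R : ℝ, 1 ≤ R →
      μ {x | descConj γ (Subgroup.centralizer ({γ} : Set _)) (fun _ h => Subgroup.mem_centralizer_singleton_iff.1 h)
            (fun y => ∏ w, F w (archPiEquivCM 2 L (Matrix.of fun i j : Fin 2 => if i.val + j.val + 1 = 2 then (1 : L) else 0) y.1 w)) x ≤ R} ≤
        ENNReal.ofReal (A * R ^ a * (1 + Real.log R) ^ m) := by
  classical
  -- topological instances on the factors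
  haveI : ∀ w : {w : InfinitePlace L // w.IsComplex}, SecondCountableTopology ↥(archLocal L 2 (Matrix.of fun i j : Fin 2 => if i.val + j.val + 1 = 2 then (1 : L) else 0) w) :=
    fun w => secondCountableTopology_archLocal L 2 _ w
  haveI : ∀ w : {w : InfinitePlace L // w.IsComplex}, LocallyCompactSpace ↥(archLocal L 2 (Matrix.of fun i j : Fin 2 => if i.val + j.val + 1 = 2 then (1 : L) else 0) w) :=
    fun w => locallyCompactSpace_archLocal L 2 _ w
  haveI := secondCountableTopology_mixedSpaceGL L 1
  haveI : SecondCountableTopology ↥(UnitaryGroup.arch (↥(maximalRealSubfield L)) L (IsCMField.complexConj L) 1 (Matrix.of fun i j : Fin 1 => if i.val + j.val + 1 = 1 then (1 : L) else 0)) :=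
    Topology.IsEmbedding.subtypeVal.secondCountableTopology
  haveI : CompactSpace ↥(UnitaryGroup.arch (↥(maximalRealSubfield L)) L (IsCMField.complexConj L) 1 (Matrix.of fun i j : Fin 1 => if i.val + j.val + 1 = 1 then (1 : L) else 0)) := by
    refine isCompact_iff_compactSpace.1 (UnitaryGroup.isCompact_arch_cm (N := 1) (L := L) (H := _) fun w => Or.inl ?_)
    have h1 : (Matrix.of fun i j : Fin 1 => if i.val + j.val + 1 = 1 then (1 : L) else 0).map w.1.embedding = 1 := by
      ext i j; fin_cases i; fin_cases j; simp [Matrix.map_apply]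
    rw [h1]
    exact Matrix.PosDef.one
  -- the iso `Ψ = archPiEquivCM⁻¹ × id : (Π_w U(Φ₂)_w) × U(Φ₁)_∞ ≃* H_∞`
  let Ψ : ((∀ w : {w : InfinitePlace L // w.IsComplex}, ↥(archLocal L 2 (Matrix.of fun i j : Fin 2 => if i.val + j.val + 1 = 2 then (1 : L) else 0) w)) × ↥(UnitaryGroup.arch (↥(maximalRealSubfield L)) L (IsCMField.complexConj L) 1 (Matrix.of fun i j : Fin 1 => if i.val + j.val + 1 = 1 then (1 : L) else 0))) ≃* (↥(UnitaryGroup.arch (↥(maximalRealSubfield L)) L (IsCMField.complexConj L) 2 (Matrix.of fun i j : Fin 2 => if i.val + j.val + 1 = 2 then (1 : L) else 0)) × ↥(UnitaryGroup.arch (↥(maximalRealSubfield L)) L (IsCMField.complexConj L) 1 (Matrix.of fun i j : Fin 1 => if i.val + j.val + 1 = 1 then (1 : L) else 0))) :=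
    (archPiEquivCM 2 L (Matrix.of fun i j : Fin 2 => if i.val + j.val + 1 = 2 then (1 : L) else 0)).symm.toMulEquiv.prodCongr (MulEquiv.refl _)
  have hΨapply : ∀ (b : ∀ w : {w : InfinitePlace L // w.IsComplex}, ↥(archLocal L 2 (Matrix.of fun i j : Fin 2 => if i.val + j.val + 1 = 2 then (1 : L) else 0) w)) (k : ↥(UnitaryGroup.arch (↥(maximalRealSubfield L)) L (IsCMField.complexConj L) 1 (Matrix.of fun i j : Fin 1 => if i.val + j.val + 1 = 1 then (1 : L) else 0))),
      Ψ (b, k) = ((archPiEquivCM 2 L (Matrix.of fun i j : Fin 2 => if i.val + j.val + 1 = 2 then (1 : L) else 0)).symm b, k) := fun b k => rfl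
  have hΨsymm : ∀ y : ↥(UnitaryGroup.arch (↥(maximalRealSubfield L)) L (IsCMField.complexConj L) 2 (Matrix.of fun i j : Fin 2 => if i.val + j.val + 1 = 2 then (1 : L) else 0)) × ↥(UnitaryGroup.arch (↥(maximalRealSubfield L)) L (IsCMField.complexConj L) 1 (Matrix.of fun i j : Fin 1 => if i.val + j.val + 1 = 1 then (1 : L) else 0)), Ψ.symm y = (fun w => archPiEquivCM 2 L (Matrix.of fun i j : Fin 2 => if i.val + j.val + 1 = 2 then (1 : L) else 0) y.1 w, y.2) := fun y => rfl
  have hΨc : Continuous Ψ := by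
    have h : (⇑Ψ) = fun p => ((archPiEquivCM 2 L (Matrix.of fun i j : Fin 2 => if i.val + j.val + 1 = 2 then (1 : L) else 0)).symm p.1, p.2) := funext fun p => hΨapply p.1 p.2
    rw [h]
    exact ((archPiEquivCM 2 L (Matrix.of fun i j : Fin 2 => if i.val + j.val + 1 = 2 then (1 : L) else 0)).symm.continuous.comp continuous_fst).prodMk continuous_snd
  have hΨs : Continuous Ψ.symm := by
    have h : (⇑Ψ.symm) = fun y => (fun w => archPiEquivCM 2 L (Matrix.of fun i j : Fin 2 => if i.val + j.val + 1 = 2 then (1 : L) else 0) y.1 w, y.2) := funext hΨsymm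
    rw [h]
    exact ((archPiEquivCM 2 L (Matrix.of fun i j : Fin 2 => if i.val + j.val + 1 = 2 then (1 : L) else 0)).continuous.comp continuous_fst).prodMk continuous_snd
  have hγ : Ψ (fun w => archPiEquivCM 2 L (Matrix.of fun i j : Fin 2 => if i.val + j.val + 1 = 2 then (1 : L) else 0) γ.1 w, γ.2) = γ := by
    rw [hΨapply]
    have h1 : (fun w => archPiEquivCM 2 L (Matrix.of fun i j : Fin 2 => if i.val + j.val + 1 = 2 then (1 : L) else 0) γ.1 w) = archPiEquivCM 2 L (Matrix.of fun i j : Fin 2 => if i.val + j.val + 1 = 2 then (1 : L) else 0) γ.1 := rfl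
    rw [h1, ContinuousMulEquiv.symm_apply_apply]
  have hΦ : ∀ (b : ∀ w : {w : InfinitePlace L // w.IsComplex}, ↥(archLocal L 2 (Matrix.of fun i j : Fin 2 => if i.val + j.val + 1 = 2 then (1 : L) else 0) w)) (k : ↥(UnitaryGroup.arch (↥(maximalRealSubfield L)) L (IsCMField.complexConj L) 1 (Matrix.of fun i j : Fin 1 => if i.val + j.val + 1 = 1 then (1 : L) else 0))),
      (fun y : ↥(UnitaryGroup.arch (↥(maximalRealSubfield L)) L (IsCMField.complexConj L) 2 (Matrix.of fun i j : Fin 2 => if i.val + j.val + 1 = 2 then (1 : L) else 0)) × ↥(UnitaryGroup.arch (↥(maximalRealSubfield L)) L (IsCMField.complexConj L) 1 (Matrix.of fun i j : Fin 1 => if i.val + j.val + 1 = 1 then (1 : L) else 0)) => ∏ w, F w (archPiEquivCM 2 L (Matrix.of fun i j : Fin 2 => if i.val + j.val + 1 = 2 then (1 : L) else 0) y.1 w)) (Ψ (b, k)) = ∏ w, F w (b w) := by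
    intro b k
    rw [hΨapply]
    simp only [ContinuousMulEquiv.apply_symm_apply]
  exact measure_setOf_descConj_le_of_piProd_marginal_growth Ψ hΨc hΨs hγ μ μw hμw
    (Φ := fun y : ↥(UnitaryGroup.arch (↥(maximalRealSubfield L)) L (IsCMField.complexConj L) 2 (Matrix.of fun i j : Fin 2 => if i.val + j.val + 1 = 2 then (1 : L) else 0)) × ↥(UnitaryGroup.arch (↥(maximalRealSubfield L)) L (IsCMField.complexConj L) 1 (Matrix.of fun i j : Fin 1 => if i.val + j.val + 1 = 1 then (1 : L) else 0)) => ∏ w, F w (archPiEquivCM 2 L (Matrix.of fun i j : Fin 2 => if i.val + j.val + 1 = 2 then (1 : L) else 0) y.1 w)) (f := F) hΦ hF1 ha hgrowth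

/-- **THE HILBERT–SCHMIDT READING = the `hvol` binder of ★ `integrable_descConj_of_archSchwartzGL_of_volumeGrowth` TOKEN FOR TOKEN.**  For `γ ∈ H_∞`, ANY
`H_∞`-invariant measure `μ` on `H_∞ ⧸ Z(γ)` finite on compact sets, and per complex place `w` ANY ONE non-zero invariant σ-finite `μ_w` on `U(Φ₂)_w ⧸ Z_w(γ_w)` finite on
compact sets whose orbit HS-balls grow polynomially, `μ_w{ȳ ∣ ‖ȳ γ_w ȳ⁻¹‖²_HS + 1 ≤ ρ} ≤ C ρ^a` (`ρ ≥ 1`), one has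
`μ{ȳ Z(γ) ∣ archHSGL(ι_∞(ȳ γ ȳ⁻¹)) ≤ R} ≤ A R^a (1 + log R)^m` for `R ≥ 1` (★ `archHSGL_endoEmbArch`: `archHSGL ∘ ι_∞ = ∏_w (‖·_{2,w}‖²_HS + 1)`).  At `a = 1∕2` this is
Harish-Chandra's volume estimate behind the convergence of Schwartz orbital integrals on `H_∞`, reduced to the two per-place statements (elliptic `γ_w`: compact
`Z_w`; split `γ_w`: the `K·N` reading). [cite: BeuzartPlessis2020Asterisque, §1.5 (1.5.2)–(1.5.3) p. 31] [cite: HarishChandra1966, §9] [cite: Rogawski1990, §4.9 Prop. 4.9.1 (a) p. 55; §14.3 p. 234] -/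
theorem measure_setOf_descConj_archHSGL_endoEmbArch_le
    (γ : ↥(UnitaryGroup.arch (↥(maximalRealSubfield L)) L (IsCMField.complexConj L) 2 (Matrix.of fun i j : Fin 2 => if i.val + j.val + 1 = 2 then (1 : L) else 0)) ×
      ↥(UnitaryGroup.arch (↥(maximalRealSubfield L)) L (IsCMField.complexConj L) 1 (Matrix.of fun i j : Fin 1 => if i.val + j.val + 1 = 1 then (1 : L) else 0)))
    [MeasurableSpace ((↥(UnitaryGroup.arch (↥(maximalRealSubfield L)) L (IsCMField.complexConj L) 2 (Matrix.of fun i j : Fin 2 => if i.val + j.val + 1 = 2 then (1 : L) else 0)) ×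
      ↥(UnitaryGroup.arch (↥(maximalRealSubfield L)) L (IsCMField.complexConj L) 1 (Matrix.of fun i j : Fin 1 => if i.val + j.val + 1 = 1 then (1 : L) else 0))) ⧸
        Subgroup.centralizer ({γ} : Set _))]
    [BorelSpace ((↥(UnitaryGroup.arch (↥(maximalRealSubfield L)) L (IsCMField.complexConj L) 2 (Matrix.of fun i j : Fin 2 => if i.val + j.val + 1 = 2 then (1 : L) else 0)) ×
      ↥(UnitaryGroup.arch (↥(maximalRealSubfield L)) L (IsCMField.complexConj L) 1 (Matrix.of fun i j : Fin 1 => if i.val + j.val + 1 = 1 then (1 : L) else 0))) ⧸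
        Subgroup.centralizer ({γ} : Set _))]
    (μ : Measure ((↥(UnitaryGroup.arch (↥(maximalRealSubfield L)) L (IsCMField.complexConj L) 2 (Matrix.of fun i j : Fin 2 => if i.val + j.val + 1 = 2 then (1 : L) else 0)) ×
      ↥(UnitaryGroup.arch (↥(maximalRealSubfield L)) L (IsCMField.complexConj L) 1 (Matrix.of fun i j : Fin 1 => if i.val + j.val + 1 = 1 then (1 : L) else 0))) ⧸
        Subgroup.centralizer ({γ} : Set _)))
    [SMulInvariantMeasure (↥(UnitaryGroup.arch (↥(maximalRealSubfield L)) L (IsCMField.complexConj L) 2 (Matrix.of fun i j : Fin 2 => if i.val + j.val + 1 = 2 then (1 : L) else 0)) ×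
      ↥(UnitaryGroup.arch (↥(maximalRealSubfield L)) L (IsCMField.complexConj L) 1 (Matrix.of fun i j : Fin 1 => if i.val + j.val + 1 = 1 then (1 : L) else 0))) _ μ]
    [IsFiniteMeasureOnCompacts μ]
    [∀ w : {w : InfinitePlace L // w.IsComplex}, MeasurableSpace (↥(archLocal L 2 (Matrix.of fun i j : Fin 2 => if i.val + j.val + 1 = 2 then (1 : L) else 0) w) ⧸
      Subgroup.centralizer ({archPiEquivCM 2 L (Matrix.of fun i j : Fin 2 => if i.val + j.val + 1 = 2 then (1 : L) else 0) γ.1 w} : Set _))]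
    [∀ w : {w : InfinitePlace L // w.IsComplex}, BorelSpace (↥(archLocal L 2 (Matrix.of fun i j : Fin 2 => if i.val + j.val + 1 = 2 then (1 : L) else 0) w) ⧸
      Subgroup.centralizer ({archPiEquivCM 2 L (Matrix.of fun i j : Fin 2 => if i.val + j.val + 1 = 2 then (1 : L) else 0) γ.1 w} : Set _))]
    (μw : ∀ w : {w : InfinitePlace L // w.IsComplex}, Measure (↥(archLocal L 2 (Matrix.of fun i j : Fin 2 => if i.val + j.val + 1 = 2 then (1 : L) else 0) w) ⧸
      Subgroup.centralizer ({archPiEquivCM 2 L (Matrix.of fun i j : Fin 2 => if i.val + j.val + 1 = 2 then (1 : L) else 0) γ.1 w} : Set _)))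
    [∀ w, SMulInvariantMeasure (↥(archLocal L 2 (Matrix.of fun i j : Fin 2 => if i.val + j.val + 1 = 2 then (1 : L) else 0) w)) _ (μw w)]
    [∀ w, IsFiniteMeasureOnCompacts (μw w)] [∀ w, SigmaFinite (μw w)] (hμw : ∀ w, μw w ≠ 0)
    {a : ℝ} (ha : 0 ≤ a)
    (hgrowth : ∀ w, ∃ C : ℝ, ∀ ρ : ℝ, 1 ≤ ρ →
      μw w {x | descConj (archPiEquivCM 2 L (Matrix.of fun i j : Fin 2 => if i.val + j.val + 1 = 2 then (1 : L) else 0) γ.1 w) _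
        (centralizer_comm _)
        (fun y : ↥(archLocal L 2 (Matrix.of fun i j : Fin 2 => if i.val + j.val + 1 = 2 then (1 : L) else 0) w) =>
          ∑ i : Fin 2, ∑ j : Fin 2, ‖((y : GL (Fin 2) ℂ) : Matrix (Fin 2) (Fin 2) ℂ) i j‖ ^ 2 + 1) x ≤ ρ} ≤ ENNReal.ofReal (C * ρ ^ a)) :
    ∃ (A : ℝ) (m : ℕ), ∀ R : ℝ, 1 ≤ R →
      μ {x | descConj γ (Subgroup.centralizer ({γ} : Set _)) (fun _ h => Subgroup.mem_centralizer_singleton_iff.1 h)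
            (fun y => archHSGL L 3 ((endoEmbArch L y).val : GL (Fin 3) (mixedSpace L))) x ≤ R} ≤
        ENNReal.ofReal (A * R ^ a * (1 + Real.log R) ^ m) := by
  classical
  obtain ⟨A, m, hA⟩ := measure_setOf_descConj_prod_place_le_of_marginal_growth L γ μ μw hμw
    (fun w (y : ↥(archLocal L 2 (Matrix.of fun i j : Fin 2 => if i.val + j.val + 1 = 2 then (1 : L) else 0) w)) =>
      ∑ i : Fin 2, ∑ j : Fin 2, ‖((y : GL (Fin 2) ℂ) : Matrix (Fin 2) (Fin 2) ℂ) i j‖ ^ 2 + 1)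
    (fun w y => by
      have : (0 : ℝ) ≤ ∑ i : Fin 2, ∑ j : Fin 2, ‖((y : GL (Fin 2) ℂ) : Matrix (Fin 2) (Fin 2) ℂ) i j‖ ^ 2 :=
        Finset.sum_nonneg fun _ _ => Finset.sum_nonneg fun _ _ => by positivity
      linarith) ha hgrowth
  refine ⟨A, m, fun R hR => ?_⟩
  have hset : {x | descConj γ (Subgroup.centralizer ({γ} : Set _)) (fun _ h => Subgroup.mem_centralizer_singleton_iff.1 h)
            (fun y => archHSGL L 3 ((endoEmbArch L y).val : GL (Fin 3) (mixedSpace L))) x ≤ R} =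
      {x | descConj γ (Subgroup.centralizer ({γ} : Set _)) (fun _ h => Subgroup.mem_centralizer_singleton_iff.1 h)
            (fun y => ∏ w, (∑ i : Fin 2, ∑ j : Fin 2, ‖(((archPiEquivCM 2 L (Matrix.of fun i j : Fin 2 => if i.val + j.val + 1 = 2 then (1 : L) else 0) y.1 w :
              ↥(archLocal L 2 (Matrix.of fun i j : Fin 2 => if i.val + j.val + 1 = 2 then (1 : L) else 0) w)) : GL (Fin 2) ℂ) : Matrix (Fin 2) (Fin 2) ℂ) i j‖ ^ 2 + 1)) x ≤ R} := by
    ext x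
    induction x using QuotientGroup.induction_on with
    | H y =>
      simp only [Set.mem_setOf_eq, descConj_mk]
      rw [archHSGL_endoEmbArch]
      rfl
  rw [hset]
  exact hA R hR

/-- **(D3) THE (W_H) READING — the `hD3` binder of ★ `integrable_orbitalIntegrand_of_archSchwartzGL_of_placewise_growth` (LH3-p04, p848924) BY NAME.**  For the Weil-form
family `mH` of ★ `ArchCompatibleFamiliesH` ((W_H) = ★ `IsQuotientOf (IsArchGRegular L) νH tH`: `mH c = dν_H ∕ dt_H` at the `G`-regular classes) and a `G`-regular class
`c`, the orbit HS-balls of `mH c` grow like `A R^a (1 + log R)^m` as soon as, at each complex place `w`, SOME non-zero invariant σ-finite measure on `U(Φ₂)_w ⧸ Z_w((c.out)_{2,w})`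
finite on compact sets has orbit HS-balls growing like `C ρ^a` (`mH c` is invariant and Radon: ★ `smulInvariantMeasure_quotientMeasure'`, ★ `regular_quotientMeasure`; then
`measure_setOf_descConj_archHSGL_endoEmbArch_le`).  Consumer: `hD3 := fun hW hc μw _ _ _ hμw hplace => measure_setOf_descConj_archHSGL_endoEmbArch_le_of_isQuotientOf L νH tH mH hW c hc μw hμw (by norm_num) hplace`.
[cite: Rogawski1990, §4.3 (4.3.1) p. 43; §1.7 p. 6; §14.3 p. 234] [cite: BeuzartPlessis2020Asterisque, §1.5 (1.5.2)–(1.5.3) p. 31] [cite: DeitmarEchterhoff2014, Thm. 1.5.3] -/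
theorem measure_setOf_descConj_archHSGL_endoEmbArch_le_of_isQuotientOf
    [MeasurableSpace (↥(UnitaryGroup.arch (↥(maximalRealSubfield L)) L (IsCMField.complexConj L) 2 (Matrix.of fun i j : Fin 2 => if i.val + j.val + 1 = 2 then (1 : L) else 0)) ×
      ↥(UnitaryGroup.arch (↥(maximalRealSubfield L)) L (IsCMField.complexConj L) 1 (Matrix.of fun i j : Fin 1 => if i.val + j.val + 1 = 1 then (1 : L) else 0)))]
    [BorelSpace (↥(UnitaryGroup.arch (↥(maximalRealSubfield L)) L (IsCMField.complexConj L) 2 (Matrix.of fun i j : Fin 2 => if i.val + j.val + 1 = 2 then (1 : L) else 0)) ×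
      ↥(UnitaryGroup.arch (↥(maximalRealSubfield L)) L (IsCMField.complexConj L) 1 (Matrix.of fun i j : Fin 1 => if i.val + j.val + 1 = 1 then (1 : L) else 0)))]
    (νH : Measure (↥(UnitaryGroup.arch (↥(maximalRealSubfield L)) L (IsCMField.complexConj L) 2 (Matrix.of fun i j : Fin 2 => if i.val + j.val + 1 = 2 then (1 : L) else 0)) ×
      ↥(UnitaryGroup.arch (↥(maximalRealSubfield L)) L (IsCMField.complexConj L) 1 (Matrix.of fun i j : Fin 1 => if i.val + j.val + 1 = 1 then (1 : L) else 0))))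
    [νH.IsHaarMeasure] [νH.IsMulRightInvariant]
    [∀ a : ↥(UnitaryGroup.arch (↥(maximalRealSubfield L)) L (IsCMField.complexConj L) 2 (Matrix.of fun i j : Fin 2 => if i.val + j.val + 1 = 2 then (1 : L) else 0)) ×
        ↥(UnitaryGroup.arch (↥(maximalRealSubfield L)) L (IsCMField.complexConj L) 1 (Matrix.of fun i j : Fin 1 => if i.val + j.val + 1 = 1 then (1 : L) else 0)),
      MeasurableSpace ((↥(UnitaryGroup.arch (↥(maximalRealSubfield L)) L (IsCMField.complexConj L) 2 (Matrix.of fun i j : Fin 2 => if i.val + j.val + 1 = 2 then (1 : L) else 0)) ×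
        ↥(UnitaryGroup.arch (↥(maximalRealSubfield L)) L (IsCMField.complexConj L) 1 (Matrix.of fun i j : Fin 1 => if i.val + j.val + 1 = 1 then (1 : L) else 0))) ⧸
          Subgroup.centralizer ({a} : Set _))]
    [∀ a : ↥(UnitaryGroup.arch (↥(maximalRealSubfield L)) L (IsCMField.complexConj L) 2 (Matrix.of fun i j : Fin 2 => if i.val + j.val + 1 = 2 then (1 : L) else 0)) ×
        ↥(UnitaryGroup.arch (↥(maximalRealSubfield L)) L (IsCMField.complexConj L) 1 (Matrix.of fun i j : Fin 1 => if i.val + j.val + 1 = 1 then (1 : L) else 0)),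
      BorelSpace ((↥(UnitaryGroup.arch (↥(maximalRealSubfield L)) L (IsCMField.complexConj L) 2 (Matrix.of fun i j : Fin 2 => if i.val + j.val + 1 = 2 then (1 : L) else 0)) ×
        ↥(UnitaryGroup.arch (↥(maximalRealSubfield L)) L (IsCMField.complexConj L) 1 (Matrix.of fun i j : Fin 1 => if i.val + j.val + 1 = 1 then (1 : L) else 0))) ⧸
          Subgroup.centralizer ({a} : Set _))]
    (tH : ∀ γH : ↥(UnitaryGroup.arch (↥(maximalRealSubfield L)) L (IsCMField.complexConj L) 2 (Matrix.of fun i j : Fin 2 => if i.val + j.val + 1 = 2 then (1 : L) else 0)) ×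
        ↥(UnitaryGroup.arch (↥(maximalRealSubfield L)) L (IsCMField.complexConj L) 1 (Matrix.of fun i j : Fin 1 => if i.val + j.val + 1 = 1 then (1 : L) else 0)),
      Measure ↥(Subgroup.centralizer ({γH} : Set _)))
    (mH : OrbitalMeasureFamily (↥(UnitaryGroup.arch (↥(maximalRealSubfield L)) L (IsCMField.complexConj L) 2 (Matrix.of fun i j : Fin 2 => if i.val + j.val + 1 = 2 then (1 : L) else 0)) ×
      ↥(UnitaryGroup.arch (↥(maximalRealSubfield L)) L (IsCMField.complexConj L) 1 (Matrix.of fun i j : Fin 1 => if i.val + j.val + 1 = 1 then (1 : L) else 0))))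
    (hW : mH.IsQuotientOf (IsArchGRegular L) νH tH)
    (c : ConjClasses (↥(UnitaryGroup.arch (↥(maximalRealSubfield L)) L (IsCMField.complexConj L) 2 (Matrix.of fun i j : Fin 2 => if i.val + j.val + 1 = 2 then (1 : L) else 0)) ×
      ↥(UnitaryGroup.arch (↥(maximalRealSubfield L)) L (IsCMField.complexConj L) 1 (Matrix.of fun i j : Fin 1 => if i.val + j.val + 1 = 1 then (1 : L) else 0))))
    (hc : IsArchGRegular L (Quotient.out c))
    [∀ w : {w : InfinitePlace L // w.IsComplex}, MeasurableSpace (↥(archLocal L 2 (Matrix.of fun i j : Fin 2 => if i.val + j.val + 1 = 2 then (1 : L) else 0) w) ⧸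
      Subgroup.centralizer ({archPiEquivCM 2 L (Matrix.of fun i j : Fin 2 => if i.val + j.val + 1 = 2 then (1 : L) else 0) (Quotient.out c).1 w} : Set _))]
    [∀ w : {w : InfinitePlace L // w.IsComplex}, BorelSpace (↥(archLocal L 2 (Matrix.of fun i j : Fin 2 => if i.val + j.val + 1 = 2 then (1 : L) else 0) w) ⧸
      Subgroup.centralizer ({archPiEquivCM 2 L (Matrix.of fun i j : Fin 2 => if i.val + j.val + 1 = 2 then (1 : L) else 0) (Quotient.out c).1 w} : Set _))]
    (μw : ∀ w : {w : InfinitePlace L // w.IsComplex}, Measure (↥(archLocal L 2 (Matrix.of fun i j : Fin 2 => if i.val + j.val + 1 = 2 then (1 : L) else 0) w) ⧸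
      Subgroup.centralizer ({archPiEquivCM 2 L (Matrix.of fun i j : Fin 2 => if i.val + j.val + 1 = 2 then (1 : L) else 0) (Quotient.out c).1 w} : Set _)))
    [∀ w, SMulInvariantMeasure (↥(archLocal L 2 (Matrix.of fun i j : Fin 2 => if i.val + j.val + 1 = 2 then (1 : L) else 0) w)) _ (μw w)]
    [∀ w, IsFiniteMeasureOnCompacts (μw w)] [∀ w, SigmaFinite (μw w)] (hμw : ∀ w, μw w ≠ 0)
    {a : ℝ} (ha : 0 ≤ a)
    (hplace : ∀ w, ∃ C : ℝ, ∀ ρ : ℝ, 1 ≤ ρ →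
      μw w {x | descConj (archPiEquivCM 2 L (Matrix.of fun i j : Fin 2 => if i.val + j.val + 1 = 2 then (1 : L) else 0) (Quotient.out c).1 w)
        (Subgroup.centralizer ({archPiEquivCM 2 L (Matrix.of fun i j : Fin 2 => if i.val + j.val + 1 = 2 then (1 : L) else 0) (Quotient.out c).1 w} : Set _))
        (fun _ h => Subgroup.mem_centralizer_singleton_iff.1 h)
        (fun y : ↥(archLocal L 2 (Matrix.of fun i j : Fin 2 => if i.val + j.val + 1 = 2 then (1 : L) else 0) w) =>
          ∑ i : Fin 2, ∑ j : Fin 2, ‖((y : GL (Fin 2) ℂ) : Matrix (Fin 2) (Fin 2) ℂ) i j‖ ^ 2 + 1) x ≤ ρ} ≤ ENNReal.ofReal (C * ρ ^ a)) :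
    ∃ (A : ℝ) (m : ℕ), ∀ R : ℝ, 1 ≤ R →
      (mH c) {x | descConj (Quotient.out c) (Subgroup.centralizer ({Quotient.out c} : Set _)) (fun _ h => Subgroup.mem_centralizer_singleton_iff.1 h)
            (fun y => archHSGL L 3 ((endoEmbArch L y).val : GL (Fin 3) (mixedSpace L))) x ≤ R} ≤
        ENNReal.ofReal (A * R ^ a * (1 + Real.log R) ^ m) := by
  -- (W_H) at the `G`-regular class `c`: `mH c` IS the quotient of `νH` by the Haar measure `tH (out c)`
  obtain ⟨hHaar, hInv, hmc⟩ := hW c hc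
  rw [hmc]
  exact measure_setOf_descConj_archHSGL_endoEmbArch_le L (Quotient.out c) _ μw hμw ha hplace

end HInfty

end Literature.NumberTheory.Rogawski1990

end
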